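import Literature.AlgebraicGeometry.Smoothening.ChartCentre
import Literature.AlgebraicGeometry.Smoothening.DilatationChart
import Literature.AlgebraicGeometry.Smoothening.PointDefect
import Mathlib.RingTheory.DiscreteValuationRing.Basic
import HarnessLib

/-!
# The data of one step of the smoothening process in chart coordinates (BLR 3.4)

Topic: `Literature/AlgebraicGeometry/Smoothening` (Bosch–Lütkebohmert–Raynaud, *Néron Models*,
§3.4, proof of Thm. 2). Given a chart `X = Spec A`, `A = R[T₁, …, T_N]/I`, equations `g₁, …, g_r`
of the centre and the open `D(h)`, we pass to the chart `R[T, U]/I'` of `X ∩ D(h)` (`OpenChart`),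
take the centre `𝔠 = (ϖ, g, hU - 1)` (`ChartCentre`) and present its dilatation as
`R[T, U, Z]/I''` (`DilatationChart`). This file carries the *data* of the step: the structure map
`toDilChart : A → R[T, U, Z]/I''`, the centre ring as an algebra over the chart
(`algebraQuotCentre`), and, for a point `a : A → S` with `a(h̄)` a unit reducing into the centre,
the chart point, the dilatation point and the lifted point `a''` of `R[T, U, Z]/I''`
(`chartPoint`, `dilatationPoint`, `dilChartPoint`), its uniqueness (`eq_dilChartPoint`) and the
residue map of the centre at the point (`centreResidue`). The defect inequality of the step is
`ForestStep.forest_step`. [folklore]; no named facts (D-0026).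

## References

* S. Bosch, W. Lütkebohmert, M. Raynaud, *Néron Models*, Springer 1990, §3.2, §3.4 (proof of
  Thm. 2). [BLRNeronModels1990] (Not held; numbers only.)
-/

noncomputable section

open MvPolynomial IsLocalRing
open Literature.AlgebraicGeometry.Dilatations Literature.AlgebraicGeometry.Resolution

namespace Literature.AlgebraicGeometry.Smoothening

universe u

/-! ### The data of a step -/

section Step

variable {R : Type u} [CommRing R] (ϖ : R) {N r : ℕ} (I : Ideal (MvPolynomial (Fin N) R))
  (g : Fin r → MvPolynomial (Fin N) R) (h : MvPolynomial (Fin N) R)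

/-- `I' ≤ 𝔠`: the ideal of the chart of `X ∩ D(h)` is contained in the centre
`𝔠 = (ϖ, g, hU - 1)` as soon as `h·I ⊆ (ϖ, g)`. [folklore] -/
theorem chartIdeal_le_centre (hIg : ∀ x ∈ I, h * x ∈ centreIdealB ϖ g) :
    chartIdeal I h ≤ centreIdealB ϖ (chartGens g h) :=
  chartIdeal_le I h _ (rel_mem_centreIdealB ϖ g h) fun x hx =>
    map_centreIdealB_le ϖ g h (Ideal.mem_map_of_mem _ (hIg x hx))

/-- The centre ring `C = R[T, U]/𝔠` as an algebra over the chart `R[T, U]/I'`. [folklore] -/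
abbrev algebraQuotCentre (hle : chartIdeal I h ≤ centreIdealB ϖ (chartGens g h)) :
    Algebra (MvPolynomial (Fin (N + 1)) R ⧸ chartIdeal I h)
      (MvPolynomial (Fin (N + 1)) R ⧸ centreIdealB ϖ (chartGens g h)) :=
  (Ideal.Quotient.factor hle).toAlgebra

/-- `R[T, U] → R[T, U]/I' → R[T, U]/𝔠` is a tower. [folklore] -/
theorem isScalarTower_quotCentre (hle : chartIdeal I h ≤ centreIdealB ϖ (chartGens g h)) :
    letI := algebraQuotCentre ϖ I g h hle
    IsScalarTower (MvPolynomial (Fin (N + 1)) R) (MvPolynomial (Fin (N + 1)) R ⧸ chartIdeal I h)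
      (MvPolynomial (Fin (N + 1)) R ⧸ centreIdealB ϖ (chartGens g h)) :=
  letI := algebraQuotCentre ϖ I g h hle
  IsScalarTower.of_algebraMap_eq (R := MvPolynomial (Fin (N + 1)) R) (S := MvPolynomial (Fin (N + 1)) R ⧸ chartIdeal I h)
    (A := MvPolynomial (Fin (N + 1)) R ⧸ centreIdealB ϖ (chartGens g h)) fun _ => rfl

/-- `R → R[T, U]/I' → R[T, U]/𝔠` is a tower. [folklore] -/
theorem isScalarTower_quotCentre' (hle : chartIdeal I h ≤ centreIdealB ϖ (chartGens g h)) :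
    letI := algebraQuotCentre ϖ I g h hle
    IsScalarTower R (MvPolynomial (Fin (N + 1)) R ⧸ chartIdeal I h)
      (MvPolynomial (Fin (N + 1)) R ⧸ centreIdealB ϖ (chartGens g h)) :=
  letI := algebraQuotCentre ϖ I g h hle
  IsScalarTower.of_algebraMap_eq (R := R) (S := MvPolynomial (Fin (N + 1)) R ⧸ chartIdeal I h)
    (A := MvPolynomial (Fin (N + 1)) R ⧸ centreIdealB ϖ (chartGens g h)) fun _ => rfl

/-- **The structure map `A → R[T, U, Z]/I''`** of the dilatation chart (through the open chart).
[folklore] -/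
def toDilChart : (MvPolynomial (Fin N) R ⧸ I) →ₐ[R]
    MvPolynomial (Fin (N + 1 + (r + 1))) R ⧸ dilIdeal ϖ (chartIdeal I h) (chartGens g h) :=
  (IsScalarTower.toAlgHom R (MvPolynomial (Fin (N + 1)) R ⧸ chartIdeal I h) _).comp
    (IsScalarTower.toAlgHom R (MvPolynomial (Fin N) R ⧸ I) _)

/-- `h` becomes a unit in the dilatation chart (it is one in the open chart `R[T, U]/I'`, where
`hU = 1`). [folklore] -/
theorem isUnit_toDilChart_apply : IsUnit (toDilChart ϖ I g h (Ideal.Quotient.mk I h)) := by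
  change IsUnit (algebraMap (MvPolynomial (Fin (N + 1)) R ⧸ chartIdeal I h)
    (MvPolynomial (Fin (N + 1 + (r + 1))) R ⧸ dilIdeal ϖ (chartIdeal I h) (chartGens g h))
    (algebraMap (MvPolynomial (Fin N) R ⧸ I) (MvPolynomial (Fin (N + 1)) R ⧸ chartIdeal I h)
      (Ideal.Quotient.mk I h)))
  rw [algebraMap_chart_mk]
  exact (isUnit_mk_rename_of_rel_mem h _ (rel_mem_chartIdeal I h)).map
    (algebraMap (MvPolynomial (Fin (N + 1)) R ⧸ chartIdeal I h)
      (MvPolynomial (Fin (N + 1 + (r + 1))) R ⧸ dilIdeal ϖ (chartIdeal I h) (chartGens g h)))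

/-- **The equations of the centre become multiples of `ϖ` in the dilatation chart**: a point of
the dilatation chart with values in a local ring in which `ϖ` is not a unit sends the `gⱼ` into
the maximal ideal. [folklore] -/
theorem apply_toDilChart_mem {S : Type u} [CommRing S] [IsLocalRing S] [Algebra R S]
    (hϖ : ¬ IsUnit (algebraMap R S ϖ))
    (b : (MvPolynomial (Fin (N + 1 + (r + 1))) R ⧸ dilIdeal ϖ (chartIdeal I h) (chartGens g h)) →ₐ[R] S)
    (j : Fin r) :
    b (toDilChart ϖ I g h (Ideal.Quotient.mk I (g j))) ∈ maximalIdeal S := by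
  have hmem : algebraMap (MvPolynomial (Fin (N + 1)) R ⧸ chartIdeal I h)
      (dilatation ϖ (centreIdeal ϖ (chartIdeal I h) (chartGens g h)))
        (algebraMap _ (MvPolynomial (Fin (N + 1)) R ⧸ chartIdeal I h) (Ideal.Quotient.mk I (g j))) ∈
      Ideal.span {algebraMap R (dilatation ϖ (centreIdeal ϖ (chartIdeal I h) (chartGens g h))) ϖ} := by
    refine map_centreIdeal_dilatation_le ϖ (chartIdeal I h) (chartGens g h)
      (Ideal.mem_map_of_mem _ ?_)
    rw [algebraMap_chart_mk, ← chartGens_castSucc g h j]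
    exact mk_mem_centreIdeal ϖ _ _ (Fin.castSucc j)
  obtain ⟨d, hd⟩ := Ideal.mem_span_singleton'.mp hmem
  change b (algebraMap (MvPolynomial (Fin (N + 1)) R ⧸ chartIdeal I h) _
    (algebraMap _ (MvPolynomial (Fin (N + 1)) R ⧸ chartIdeal I h) (Ideal.Quotient.mk I (g j)))) ∈ _
  rw [algebraMap_dil_apply, ← hd, map_mul, map_mul, AlgEquiv.commutes, AlgHom.commutes]
  exact Ideal.mul_mem_left _ _ ((IsLocalRing.mem_maximalIdeal _).mpr (mem_nonunits_iff.mpr hϖ))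

/-- A point sending `ϖ` and the `gⱼ` into the maximal ideal sends the whole lifted centre
`(ϖ, g) ⊆ R[T]` into it. [folklore] -/
theorem apply_mem_of_mem_centreIdealB {S : Type u} [CommRing S] [IsLocalRing S] [Algebra R S]
    (hϖ : ¬ IsUnit (algebraMap R S ϖ)) (a : (MvPolynomial (Fin N) R ⧸ I) →ₐ[R] S)
    (hcen : ∀ j, a (Ideal.Quotient.mk I (g j)) ∈ maximalIdeal S)
    {x : MvPolynomial (Fin N) R} (hx : x ∈ centreIdealB ϖ g) :
    a (Ideal.Quotient.mk I x) ∈ maximalIdeal S := by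
  have hle : centreIdealB ϖ g ≤
      (maximalIdeal S).comap ((a : _ →+* S).comp (Ideal.Quotient.mk I)) := by
    rw [centreIdealB, Ideal.span_le]
    rintro _ (rfl | ⟨j, rfl⟩)
    · change a (Ideal.Quotient.mk I (algebraMap R _ ϖ)) ∈ maximalIdeal S
      rw [Ideal.Quotient.mk_algebraMap, AlgHom.commutes]
      exact (IsLocalRing.mem_maximalIdeal _).mpr (mem_nonunits_iff.mpr hϖ)
    · exact hcen j
  exact hle hx

end Step

/-! ### The point and its lifts -/

section Point

variable {R : Type u} [CommRing R] (ϖ : R) {N r : ℕ} (I : Ideal (MvPolynomial (Fin N) R))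
  (g : Fin r → MvPolynomial (Fin N) R) (h : MvPolynomial (Fin N) R)
  {S : Type u} [CommRing S] [Algebra R S] (a : (MvPolynomial (Fin N) R ⧸ I) →ₐ[R] S)

/-- **The point of the open chart** defined by a point `a` of `X` with `a(h̄)` a unit
(universal property of the localisation `R[T, U]/I' = A_h̄`). [folklore] -/
def chartPoint (hh : IsUnit (a (Ideal.Quotient.mk I h))) :
    (MvPolynomial (Fin (N + 1)) R ⧸ chartIdeal I h) →ₐ[R] S :=
  letI := a.toRingHom.toAlgebra
  haveI : IsScalarTower R (MvPolynomial (Fin N) R ⧸ I) S :=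
    IsScalarTower.of_algebraMap_eq (R := R) (S := MvPolynomial (Fin N) R ⧸ I) (A := S)
      fun x => (a.commutes x).symm
  IsLocalization.Away.liftAlgHom (S := MvPolynomial (Fin (N + 1)) R ⧸ chartIdeal I h)
    (Ideal.Quotient.mk I h) (f := IsScalarTower.toAlgHom R (MvPolynomial (Fin N) R ⧸ I) S) hh

/-- The chart point extends `a`. [folklore] -/
theorem chartPoint_algebraMap (hh : IsUnit (a (Ideal.Quotient.mk I h)))
    (x : MvPolynomial (Fin N) R ⧸ I) :
    chartPoint I h a hh (algebraMap _ _ x) = a x := by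
  letI := a.toRingHom.toAlgebra
  haveI : IsScalarTower R (MvPolynomial (Fin N) R ⧸ I) S :=
    IsScalarTower.of_algebraMap_eq (R := R) (S := MvPolynomial (Fin N) R ⧸ I) (A := S)
      fun x => (a.commutes x).symm
  exact IsLocalization.Away.lift_eq (S := MvPolynomial (Fin (N + 1)) R ⧸ chartIdeal I h)
    (Ideal.Quotient.mk I h) (g := (a : _ →+* S)) hh x

/-- The chart point on classes of polynomials in `T`. [folklore] -/
theorem chartPoint_mk_rename (hh : IsUnit (a (Ideal.Quotient.mk I h))) (p : MvPolynomial (Fin N) R) :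
    chartPoint I h a hh (Ideal.Quotient.mk _ (rename Fin.castSucc p)) = a (Ideal.Quotient.mk I p) := by
  rw [← algebraMap_chart_mk, chartPoint_algebraMap]

/-- The chart point kills `hU - 1` and sends `U` to `a(h̄)⁻¹`; in particular on the last centre
generator it vanishes. [folklore] -/
theorem chartPoint_mk_chartGens_last (hh : IsUnit (a (Ideal.Quotient.mk I h))) :
    chartPoint I h a hh (Ideal.Quotient.mk _ (chartGens g h (Fin.last r))) = 0 := by
  rw [chartGens_last, Ideal.Quotient.eq_zero_iff_mem.mpr (rel_mem_chartIdeal I h), map_zero]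

variable [IsDomain S] [IsDiscreteValuationRing S]

/-- If the point reduces into `V(ḡ)` then the chart point sends every generator of the centre
`𝔠 = (ϖ, g, hU - 1)` into `𝔪_S`. [folklore] -/
theorem chartPoint_chartGens_mem (hh : IsUnit (a (Ideal.Quotient.mk I h)))
    (hcen : ∀ j, a (Ideal.Quotient.mk I (g j)) ∈ maximalIdeal S) (j : Fin (r + 1)) :
    chartPoint I h a hh (Ideal.Quotient.mk _ (chartGens g h j)) ∈ maximalIdeal S := by
  induction j using Fin.lastCases with
  | last => rw [chartPoint_mk_chartGens_last]; exact zero_mem _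
  | cast j => rw [chartGens_castSucc, chartPoint_mk_rename]; exact hcen j

/-- The chart point sends the centre `𝔠` into `𝔪_S` (`ϖ` is not a unit in `S`). [folklore] -/
theorem chartPoint_mem_of_mem_centreIdealB (hh : IsUnit (a (Ideal.Quotient.mk I h)))
    (hϖ : ¬ IsUnit (algebraMap R S ϖ))
    (hcen : ∀ j, a (Ideal.Quotient.mk I (g j)) ∈ maximalIdeal S)
    {x : MvPolynomial (Fin (N + 1)) R} (hx : x ∈ centreIdealB ϖ (chartGens g h)) :
    chartPoint I h a hh (Ideal.Quotient.mk _ x) ∈ maximalIdeal S := by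
  have hmap : (centreIdealB ϖ (chartGens g h)).map
      ((chartPoint I h a hh).toRingHom.comp (Ideal.Quotient.mk (chartIdeal I h))) ≤
        maximalIdeal S := by
    rw [centreIdealB, Ideal.map_span, Ideal.span_le, Set.image_insert_eq]
    rintro _ (rfl | ⟨_, ⟨j, rfl⟩, rfl⟩)
    · change chartPoint I h a hh (Ideal.Quotient.mk _ (algebraMap R _ ϖ)) ∈ maximalIdeal S
      rw [Ideal.Quotient.mk_algebraMap, AlgHom.commutes]
      exact (IsLocalRing.mem_maximalIdeal _).mpr (mem_nonunits_iff.mpr hϖ)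
    · exact chartPoint_chartGens_mem I g h a hh hcen j
  exact hmap (Ideal.mem_map_of_mem _ hx)

/-- **The residue map of the centre at the point**: `C = R[T, U]/𝔠 → κ(S)`, `x ↦ a₁(x) mod 𝔪_S`;
its kernel is the prime `𝔓` of the centre below the closed point. [folklore] -/
def centreResidue (hh : IsUnit (a (Ideal.Quotient.mk I h))) (hϖ : ¬ IsUnit (algebraMap R S ϖ))
    (hcen : ∀ j, a (Ideal.Quotient.mk I (g j)) ∈ maximalIdeal S) :
    (MvPolynomial (Fin (N + 1)) R ⧸ centreIdealB ϖ (chartGens g h)) →+* ResidueField S :=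
  Ideal.Quotient.lift _ ((residue S).comp ((chartPoint I h a hh).toRingHom.comp
    (Ideal.Quotient.mk (chartIdeal I h)))) fun _ hx =>
      (residue_eq_zero_iff _).mpr (chartPoint_mem_of_mem_centreIdealB ϖ I g h a hh hϖ hcen hx)

/-- The residue map of the centre on classes. [folklore] -/
@[simp]
theorem centreResidue_mk (hh : IsUnit (a (Ideal.Quotient.mk I h))) (hϖ : ¬ IsUnit (algebraMap R S ϖ))
    (hcen : ∀ j, a (Ideal.Quotient.mk I (g j)) ∈ maximalIdeal S) (x : MvPolynomial (Fin (N + 1)) R) :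
    centreResidue ϖ I g h a hh hϖ hcen (Ideal.Quotient.mk _ x) =
      residue S (chartPoint I h a hh (Ideal.Quotient.mk _ x)) := rfl


/-- **The point of the dilatation** `A₁[𝔠/ϖ] → S` defined by a point `a₁` of the chart `A₁`
reducing into the centre (universal property of the dilatation, `ϖ` a uniformizer of `S`).
[folklore] -/
def dilatationPoint (a₁ : (MvPolynomial (Fin (N + 1)) R ⧸ chartIdeal I h) →ₐ[R] S)
    (hπ : Irreducible (algebraMap R S ϖ))
    (hcen : ∀ j, a₁ (Ideal.Quotient.mk _ (chartGens g h j)) ∈ maximalIdeal S) :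
    dilatation ϖ (centreIdeal ϖ (chartIdeal I h) (chartGens g h)) →+* S :=
  dilatation.lift a₁.toRingHom
    (by
      change a₁ (algebraMap R _ ϖ) ∈ nonZeroDivisors S
      rw [AlgHom.commutes]
      exact mem_nonZeroDivisors_of_ne_zero hπ.ne_zero)
    (by
      have hϖ : a₁.toRingHom (algebraMap R _ ϖ) = algebraMap R S ϖ := a₁.commutes ϖ
      rw [hϖ, ← hπ.maximalIdeal_eq, centreIdeal, Ideal.map_span, Ideal.span_le,
        Set.image_insert_eq]
      rintro _ (rfl | ⟨_, ⟨j, rfl⟩, rfl⟩)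
      · change a₁ (algebraMap R _ ϖ) ∈ maximalIdeal S
        rw [AlgHom.commutes]
        exact (IsLocalRing.mem_maximalIdeal _).mpr (mem_nonunits_iff.mpr hπ.not_isUnit)
      · exact hcen j)

/-- The dilatation point extends `a₁`. [folklore] -/
theorem dilatationPoint_algebraMap (a₁ : (MvPolynomial (Fin (N + 1)) R ⧸ chartIdeal I h) →ₐ[R] S)
    (hπ : Irreducible (algebraMap R S ϖ))
    (hcen : ∀ j, a₁ (Ideal.Quotient.mk _ (chartGens g h j)) ∈ maximalIdeal S)
    (x : MvPolynomial (Fin (N + 1)) R ⧸ chartIdeal I h) :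
    dilatationPoint ϖ I g h a₁ hπ hcen (algebraMap _ _ x) = a₁ x :=
  dilatation.lift_algebraMap _ _ _ x

/-- **The point of the dilatation chart** `R[T, U, Z]/I'' → S`. [folklore] -/
def dilChartPoint (a₁ : (MvPolynomial (Fin (N + 1)) R ⧸ chartIdeal I h) →ₐ[R] S)
    (hπ : Irreducible (algebraMap R S ϖ))
    (hcen : ∀ j, a₁ (Ideal.Quotient.mk _ (chartGens g h j)) ∈ maximalIdeal S) :
    (MvPolynomial (Fin (N + 1 + (r + 1))) R ⧸ dilIdeal ϖ (chartIdeal I h) (chartGens g h)) →ₐ[R] S where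
  __ := (dilatationPoint ϖ I g h a₁ hπ hcen).comp
      (dilEquiv ϖ (chartIdeal I h) (chartGens g h)).toRingEquiv.toRingHom
  commutes' c := by
    change dilatationPoint ϖ I g h a₁ hπ hcen (dilEquiv ϖ (chartIdeal I h) (chartGens g h)
      (algebraMap R _ c)) = algebraMap R S c
    rw [AlgEquiv.commutes, IsScalarTower.algebraMap_apply R (MvPolynomial (Fin (N + 1)) R ⧸ chartIdeal I h)
      (dilatation ϖ (centreIdeal ϖ (chartIdeal I h) (chartGens g h))), dilatationPoint_algebraMap,
      AlgHom.commutes]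

/-- The dilatation chart point extends `a₁` along the structure map. [folklore] -/
theorem dilChartPoint_algebraMap (a₁ : (MvPolynomial (Fin (N + 1)) R ⧸ chartIdeal I h) →ₐ[R] S)
    (hπ : Irreducible (algebraMap R S ϖ))
    (hcen : ∀ j, a₁ (Ideal.Quotient.mk _ (chartGens g h j)) ∈ maximalIdeal S)
    (x : MvPolynomial (Fin (N + 1)) R ⧸ chartIdeal I h) :
    dilChartPoint ϖ I g h a₁ hπ hcen (algebraMap _ _ x) = a₁ x := by
  change (dilatationPoint ϖ I g h a₁ hπ hcen) (dilEquiv ϖ (chartIdeal I h) (chartGens g h)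
    (algebraMap _ _ x)) = a₁ x
  rw [algebraMap_dil_apply, AlgEquiv.apply_symm_apply, dilatationPoint_algebraMap]

/-- **Uniqueness of the lift**: any point of the dilatation chart restricting to `a` on `A` is
the lifted point `a''` (localisations and dilatations have epimorphic structure maps for points
with values in a domain in which `ϖ ≠ 0`). [folklore] -/
theorem eq_dilChartPoint (hh : IsUnit (a (Ideal.Quotient.mk I h))) (hπ : Irreducible (algebraMap R S ϖ))
    (hcen : ∀ j, chartPoint I h a hh (Ideal.Quotient.mk _ (chartGens g h j)) ∈ maximalIdeal S)
    (b : (MvPolynomial (Fin (N + 1 + (r + 1))) R ⧸ dilIdeal ϖ (chartIdeal I h) (chartGens g h)) →ₐ[R] S)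
    (hb : ∀ x, b (toDilChart ϖ I g h x) = a x) :
    b = dilChartPoint ϖ I g h (chartPoint I h a hh) hπ hcen := by
  -- on the open chart
  have h₁ : b.toRingHom.comp (algebraMap (MvPolynomial (Fin (N + 1)) R ⧸ chartIdeal I h) _) =
      (chartPoint I h a hh).toRingHom := by
    refine IsLocalization.ringHom_ext (Submonoid.powers (Ideal.Quotient.mk I h)) (RingHom.ext fun x => ?_)
    change b (algebraMap _ _ (algebraMap _ _ x)) = chartPoint I h a hh (algebraMap _ _ x)
    rw [chartPoint_algebraMap]
    exact hb x
  -- on the dilatation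
  have h₂ : b.toRingHom.comp (dilEquiv ϖ (chartIdeal I h) (chartGens g h)).symm.toRingEquiv.toRingHom =
        dilatationPoint ϖ I g h (chartPoint I h a hh) hπ hcen := by
    refine dilatation.ringHom_ext (φ := (chartPoint I h a hh).toRingHom) ?_ ?_
      (dilatation.lift_comp_algebraMap _ _ _)
    · change chartPoint I h a hh (algebraMap R _ ϖ) ∈ nonZeroDivisors S
      rw [AlgHom.commutes]
      exact mem_nonZeroDivisors_of_ne_zero hπ.ne_zero
    · rw [← h₁]
      refine RingHom.ext fun x => ?_
      change b ((dilEquiv ϖ (chartIdeal I h) (chartGens g h)).symm (algebraMap _ _ x)) =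
        b (algebraMap _ _ x)
      rw [← algebraMap_dil_apply]
  -- together
  refine AlgHom.ext fun y => ?_
  obtain ⟨x, rfl⟩ := (dilEquiv ϖ (chartIdeal I h) (chartGens g h)).symm.surjective y
  have hx := congrArg (fun f : _ →+* S => f x) h₂
  change b ((dilEquiv ϖ (chartIdeal I h) (chartGens g h)).symm x) = _ at hx
  rw [hx]
  change _ = dilatationPoint ϖ I g h (chartPoint I h a hh) hπ hcen
    (dilEquiv ϖ (chartIdeal I h) (chartGens g h) ((dilEquiv ϖ (chartIdeal I h) (chartGens g h)).symm x))
  rw [AlgEquiv.apply_symm_apply]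

end Point

end Literature.AlgebraicGeometry.Smoothening

end
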